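import Summits.Ventures.LatticeQCDFlow.Exactness.ReversibleAutocovMonotone
import HarnessLib

/-!
# The LOCALITY floor of a reversible sampler: `τ_int ≥ 2 Var(g)/s² − ½` per step and `≥ 2 Var(g)/(V s²) − ½` per sweep of `V` steps

HONEST FRAMING: exact (Metropolis-corrected) sampling algorithms for lattice gauge theory;
figures of merit are autocorrelation/cost numbers at stated couplings and volumes; no
continuum-physics claim.  (SCALAR calibration rung S0-A: not a gauge result.)

Venture `LatticeQCDFlow` (cell pub-lqcd), topic `Exactness`; FANOUT row 2 (`s0-phi4`: the
mechanism of CRITICAL SLOWING DOWN of local reversible updates, typed).  NEW WORK of the cell,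
composing `Exactness/ReversibleOperatorL2.lean` (Madras–Slade floor on an admissible class) and
`Exactness/ReversibleAutocovMonotone.lean` (`1 − ρ(V) ≤ V(1 − ρ(1))`, thinned floor).  Nothing is
cited as a fact.  Printed counterpart of the per-step statement, NAMED ONLY: Madras–Slade 1993,
*The Self-Avoiding Walk*, Cor. 9.2.3 (p. 304; finite state space, via the spectral theorem):
if `P` is reversible and `|g(i) − g(j)| ≤ A` whenever `P(i, j) > 0`, then
`τ_int,g ≥ 2 C_g(0)/A² − ½`.  HERE: general state space, square-integrable observables, elementary;
and the SWEEP-UNIT version (per `V` elementary updates) `τ_int ≥ 2 C_g(0)/(V A²) − ½`, which is the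
form in which critical slowing down is usually quoted (`τ_int,sweep(M) ≳ 2χ/s²`), is new work of the
cell (presearch: corpus `book:madras1993` §9.2 has the per-step form only; galaxy — none).

## Setting

As in `ReversibleOperatorL2` (weight `w ≥ 0`, admissible class `A`, operator `K` with (int),
(comb), (stab), (lin), (symm), (contr)), plus: (one) the constant `1 ∈ A` and (unit) `K 1 = 1`
(a Markov operator).  For `g ∈ A` with `g² ∈ A` the CARRÉ DU CHAMP at `x` is
`Γ(x) = K[(g(·) − g(x))²](x)` — the mean squared displacement of `g` in one step from `x`.

## What is proved (namespace `RevOp`)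

* `integral_op_mul_weight` — exactness `∫ (K f) w = ∫ f w` from (symm) + (unit);
* `op_sq_dev_eq` — `Γ(x) = K(g²)(x) − 2 g(x) (Kg)(x) + g(x)²`;
* **`two_mul_dirichlet_eq`** — the Dirichlet-form identity `2 (C(0) − C(1)) = ∫ Γ w`
  (`C(n) = ∫ g (Kⁿ g) w`);
* `dirichlet_le_of_carre_le` — a LOCALITY bound `Γ ≤ D` everywhere gives `C(0) − C(1) ≤ (D/2) ∫ w`,
  i.e. `1 − ρ(1) ≤ D/(2 Var_π g)` with `Var_π g = C(0)/∫w`;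
* **`tauInt_ge_of_carre_le`** (Madras–Slade Cor. 9.2.3, general space): `Γ ≤ D` ⇒
  `τ_int ≥ 2 C(0)/(D ∫w) − ½ = 2 Var_π(g)/D − ½` per elementary step;
* **`thinned_tauInt_ge_of_carre_le`** — per `V` elementary steps (one sweep's worth of local
  updates): `τ_int^{(V)} ≥ 2 C(0)/(V D ∫w) − ½ = 2 Var_π(g)/(V D) − ½`.

Reading (no numerics implied): a reversible sampler whose single step moves an observable `g` by at
most `s` (so `Γ ≤ D = s²`) needs `τ_int ≥ 2 Var(g)/(V s²) − ½` sweeps of `V` steps to decorrelate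
`g`: with `g` the magnetisation of a volume-`V` lattice, `Var(g) = V χ` and the floor is
`2χ/s² − ½` SWEEPS — it diverges with the susceptibility (`z ≥ γ/ν` for local reversible dynamics).
The lattice instance for row 2's local Metropolis arm is `Exactness/Phi4MetropolisCSDFloor.lean`.
NOT CLAIMED: `ρ < 1` / summability for any run (hypotheses); non-reversible sweeps (ordered site
order), for which only the ballistic floor `1 − ρ(V) ≤ V²(1 − ρ(1))`-type bounds hold in general.
-/

namespace Summit.Ventures.LatticeQCDFlow.Exactness

open Real MeasureTheory Filter Finset
open Summit.Ventures.LatticeQCDFlow.Scoring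

namespace RevOp

variable {X : Type*} [MeasurableSpace X] {μ : Measure X} {w : X → ℝ} {A : (X → ℝ) → Prop}
  {K : (X → ℝ) → (X → ℝ)}

/-- **Exactness from reversibility**: `∫ (K f) w = ∫ f w` for `f ∈ A`, from (symm) against the
constant `1 ∈ A` and `K 1 = 1`. -/
theorem integral_op_mul_weight (hA1 : A (fun _ => (1 : ℝ)))
    (hsymm : ∀ ⦃f h : X → ℝ⦄, A f → A h →
      ∫ x, K f x * h x * w x ∂μ = ∫ x, f x * K h x * w x ∂μ)
    (hunit : ∀ x, K (fun _ => (1 : ℝ)) x = 1) {f : X → ℝ} (hf : A f) :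
    ∫ x, K f x * w x ∂μ = ∫ x, f x * w x ∂μ := by
  have h := hsymm hf hA1
  simp only [hunit, mul_one] at h
  exact h

omit [MeasurableSpace X] in
/-- **The carré du champ expanded**: `K[(g(·) − g(x₀))²](x₀) = K(g²)(x₀) − 2 g(x₀) (K g)(x₀) + g(x₀)²`
(linearity twice and `K 1 = 1`). -/
theorem op_sq_dev_eq (hA1 : A (fun _ => (1 : ℝ)))
    (hAc : ∀ ⦃f h : X → ℝ⦄ (c : ℝ), A f → A h → A (fun x => f x + c * h x))
    (hlin : ∀ ⦃f h : X → ℝ⦄ (c : ℝ), A f → A h →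
      ∀ x, K (fun s => f s + c * h s) x = K f x + c * K h x)
    (hunit : ∀ x, K (fun _ => (1 : ℝ)) x = 1)
    {g : X → ℝ} (hg : A g) (hg2 : A (fun x => g x ^ 2)) (x₀ : X) :
    K (fun y => (g y - g x₀) ^ 2) x₀
      = K (fun y => g y ^ 2) x₀ - 2 * g x₀ * K g x₀ + g x₀ ^ 2 := by
  have hf : A (fun y => g y ^ 2 + (-2 * g x₀) * g y) := by
    have := hAc (-2 * g x₀) hg2 hg
    beta_reduce at this
    exact this
  have e1 : K (fun y => (g y - g x₀) ^ 2) x₀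
      = K (fun y => (g y ^ 2 + (-2 * g x₀) * g y) + g x₀ ^ 2 * 1) x₀ := by
    congr 1
    funext y
    ring
  have e2 : K (fun y => (g y ^ 2 + (-2 * g x₀) * g y) + g x₀ ^ 2 * 1) x₀
      = K (fun y => g y ^ 2 + (-2 * g x₀) * g y) x₀ + g x₀ ^ 2 * K (fun _ => (1 : ℝ)) x₀ := by
    have := hlin (g x₀ ^ 2) hf hA1 x₀
    beta_reduce at this
    exact this
  have e3 : K (fun y => g y ^ 2 + (-2 * g x₀) * g y) x₀
      = K (fun y => g y ^ 2) x₀ + (-2 * g x₀) * K g x₀ := by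
    have := hlin (-2 * g x₀) hg2 hg x₀
    beta_reduce at this
    exact this
  rw [e1, e2, e3, hunit]
  ring

/-- **THE DIRICHLET-FORM IDENTITY**: `2 (C(0) − C(1)) = ∫ Γ w`,
`Γ(x) = K[(g(·) − g(x))²](x)`, `C(0) = ∫ g² w`, `C(1) = ∫ g (Kg) w` — for a reversible Markov
operator the lag-one decorrelation of `g` is half the mean squared one-step displacement of `g`. -/
theorem two_mul_dirichlet_eq (hA1 : A (fun _ => (1 : ℝ)))
    (hAi : ∀ ⦃f h : X → ℝ⦄, A f → A h → Integrable (fun x => f x * h x * w x) μ)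
    (hAc : ∀ ⦃f h : X → ℝ⦄ (c : ℝ), A f → A h → A (fun x => f x + c * h x))
    (hAK : ∀ ⦃f : X → ℝ⦄, A f → A (K f))
    (hlin : ∀ ⦃f h : X → ℝ⦄ (c : ℝ), A f → A h →
      ∀ x, K (fun s => f s + c * h s) x = K f x + c * K h x)
    (hsymm : ∀ ⦃f h : X → ℝ⦄, A f → A h →
      ∫ x, K f x * h x * w x ∂μ = ∫ x, f x * K h x * w x ∂μ)
    (hunit : ∀ x, K (fun _ => (1 : ℝ)) x = 1)
    {g : X → ℝ} (hg : A g) (hg2 : A (fun x => g x ^ 2)) :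
    2 * ((∫ x, g x ^ 2 * w x ∂μ) - ∫ x, g x * K g x * w x ∂μ)
      = ∫ x, K (fun y => (g y - g x) ^ 2) x * w x ∂μ := by
  have e : ∀ x, K (fun y => (g y - g x) ^ 2) x * w x
      = K (fun y => g y ^ 2) x * w x + (-2) * (g x * K g x * w x) + g x ^ 2 * w x := by
    intro x
    rw [op_sq_dev_eq hA1 hAc hlin hunit hg hg2 x]
    ring
  simp_rw [e]
  have i1 : Integrable (fun x => K (fun y => g y ^ 2) x * w x) μ := by
    have := hAi (hAK hg2) hA1
    simpa only [mul_one] using this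
  have i2 : Integrable (fun x => (-2) * (g x * K g x * w x)) μ := (hAi hg (hAK hg)).const_mul _
  have i3 : Integrable (fun x => g x ^ 2 * w x) μ := integrable_sq_mul hAi hg
  have i12 : Integrable (fun x => K (fun y => g y ^ 2) x * w x + (-2) * (g x * K g x * w x)) μ :=
    i1.add i2
  rw [integral_add i12 i3, integral_add i1 i2, integral_const_mul,
    integral_op_mul_weight hA1 hsymm hunit hg2]
  ring

/-- **LOCALITY BOUND**: if the one-step mean squared displacement of `g` is at most `D` from
every state (`Γ ≤ D`), then `C(0) − C(1) ≤ (D/2) ∫ w`. -/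
theorem dirichlet_le_of_carre_le (hw0 : ∀ x, 0 ≤ w x) (hA1 : A (fun _ => (1 : ℝ)))
    (hAi : ∀ ⦃f h : X → ℝ⦄, A f → A h → Integrable (fun x => f x * h x * w x) μ)
    (hAc : ∀ ⦃f h : X → ℝ⦄ (c : ℝ), A f → A h → A (fun x => f x + c * h x))
    (hAK : ∀ ⦃f : X → ℝ⦄, A f → A (K f))
    (hlin : ∀ ⦃f h : X → ℝ⦄ (c : ℝ), A f → A h →
      ∀ x, K (fun s => f s + c * h s) x = K f x + c * K h x)
    (hsymm : ∀ ⦃f h : X → ℝ⦄, A f → A h →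
      ∫ x, K f x * h x * w x ∂μ = ∫ x, f x * K h x * w x ∂μ)
    (hunit : ∀ x, K (fun _ => (1 : ℝ)) x = 1)
    {g : X → ℝ} (hg : A g) (hg2 : A (fun x => g x ^ 2)) {D : ℝ}
    (hΓ : ∀ x, K (fun y => (g y - g x) ^ 2) x ≤ D) :
    (∫ x, g x ^ 2 * w x ∂μ) - ∫ x, g x * K g x * w x ∂μ ≤ D / 2 * ∫ x, w x ∂μ := by
  have h2 := two_mul_dirichlet_eq hA1 hAi hAc hAK hlin hsymm hunit hg hg2
  have iw : Integrable w μ := by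
    have := hAi hA1 hA1
    simpa only [mul_one, one_mul] using this
  have iΓ : Integrable (fun x => K (fun y => (g y - g x) ^ 2) x * w x) μ := by
    have i1 : Integrable (fun x => K (fun y => g y ^ 2) x * w x) μ := by
      have := hAi (hAK hg2) hA1
      simpa only [mul_one] using this
    have i2 : Integrable (fun x => (-2) * (g x * K g x * w x)) μ := (hAi hg (hAK hg)).const_mul _
    have i3 : Integrable (fun x => g x ^ 2 * w x) μ := integrable_sq_mul hAi hg
    refine ((i1.add i2).add i3).congr (Eventually.of_forall fun x => ?_)
    simp only [Pi.add_apply]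
    rw [op_sq_dev_eq hA1 hAc hlin hunit hg hg2 x]
    ring
  have hle : ∫ x, K (fun y => (g y - g x) ^ 2) x * w x ∂μ ≤ ∫ x, D * w x ∂μ :=
    integral_mono iΓ (iw.const_mul D) fun x => mul_le_mul_of_nonneg_right (hΓ x) (hw0 x)
  rw [integral_const_mul] at hle
  linarith

/-- **THE LOCALITY FLOOR PER STEP (Madras–Slade Cor. 9.2.3 on a general state space).**
`K` a reversible Markov operator on the admissible class (with `1 ∈ A`, `K1 = 1`), `g ∈ A` with
`g² ∈ A`, one-step mean squared displacement `Γ ≤ D` everywhere (e.g. `D = s²` when a step moves `g` by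
at most `s`), `Z = ∫ w`.  If the autocorrelation series of `g` is summable and
`ρ(1) < 1`, then `τ_int ≥ 2 C(0)/(D Z) − ½ = 2 Var_π(g)/D − ½`. -/
theorem tauInt_ge_of_carre_le (hw0 : ∀ x, 0 ≤ w x) (hA1 : A (fun _ => (1 : ℝ)))
    (hAi : ∀ ⦃f h : X → ℝ⦄, A f → A h → Integrable (fun x => f x * h x * w x) μ)
    (hAc : ∀ ⦃f h : X → ℝ⦄ (c : ℝ), A f → A h → A (fun x => f x + c * h x))
    (hAK : ∀ ⦃f : X → ℝ⦄, A f → A (K f))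
    (hlin : ∀ ⦃f h : X → ℝ⦄ (c : ℝ), A f → A h →
      ∀ x, K (fun s => f s + c * h s) x = K f x + c * K h x)
    (hsymm : ∀ ⦃f h : X → ℝ⦄, A f → A h →
      ∫ x, K f x * h x * w x ∂μ = ∫ x, f x * K h x * w x ∂μ)
    (hcontr : ∀ ⦃f : X → ℝ⦄, A f → ∫ x, K f x ^ 2 * w x ∂μ ≤ ∫ x, f x ^ 2 * w x ∂μ)
    (hunit : ∀ x, K (fun _ => (1 : ℝ)) x = 1)
    {g : X → ℝ} (hg : A g) (hg2 : A (fun x => g x ^ 2)) {D : ℝ}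
    (hΓ : ∀ x, K (fun y => (g y - g x) ^ 2) x ≤ D)
    (hs : Summable fun n => (∫ x, g x * (K^[n + 1] g) x * w x ∂μ) / ∫ x, g x ^ 2 * w x ∂μ)
    (hρ : (∫ x, g x * K g x * w x ∂μ) / (∫ x, g x ^ 2 * w x ∂μ) < 1) :
    2 * (∫ x, g x ^ 2 * w x ∂μ) / (D * ∫ x, w x ∂μ) - 1 / 2
      ≤ tauInt (fun n => (∫ x, g x * (K^[n] g) x * w x ∂μ) / ∫ x, g x ^ 2 * w x ∂μ) := by
  have hfloor := tauInt_ge hw0 hAi hAc hAK hlin hsymm hcontr hg hs hρ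
  have hdir := dirichlet_le_of_carre_le hw0 hA1 hAi hAc hAK hlin hsymm hunit hg hg2 hΓ
  set P := ∫ x, g x ^ 2 * w x ∂μ with hP
  set Z := ∫ x, w x ∂μ with hZdef
  have hP0 : 0 ≤ P := integral_nonneg fun x => mul_nonneg (sq_nonneg _) (hw0 x)
  rcases eq_or_lt_of_le hP0 with hz | hPpos
  · -- degenerate `P = 0`
    have ht : tauInt (fun n => (∫ x, g x * (K^[n] g) x * w x ∂μ) / P) = 1 / 2 := by
      simp only [tauInt, ← hz, div_zero, tsum_zero, add_zero]
    rw [ht, ← hz]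
    have : (0 : ℝ) ≤ 2 * 0 / (D * Z) := by simp
    simp only [mul_zero, zero_div]
    norm_num
  · -- `1 − ρ(1) ≤ (D Z/(2P)) · (1 − 0)`, then the real-variable transfer
    have h1 : 1 - (∫ x, g x * K g x * w x ∂μ) / P ≤ D * Z / (2 * P) * (1 - 0) := by
      rw [sub_zero, mul_one]
      have e : 1 - (∫ x, g x * K g x * w x ∂μ) / P = (P - ∫ x, g x * K g x * w x ∂μ) / P := by
        field_simp
      rw [e, div_le_div_iff₀ hPpos (by positivity)]
      nlinarith [hdir, hPpos]
    have ht := floor_transfer hρ h1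
    have e2 : 1 / (D * Z / (2 * P) * (1 - (0 : ℝ))) = 2 * P / (D * Z) := by
      rw [sub_zero, mul_one, one_div_div]
    rw [e2] at ht
    exact ht.trans hfloor

/-- **THE LOCALITY FLOOR PER SWEEP — CRITICAL SLOWING DOWN OF LOCAL REVERSIBLE DYNAMICS.**
Same setting; observe the sampler every `V ≥ 1` elementary steps.  If the thinned series is summable
and `ρ(V) < 1`, then `τ_int^{(V)} = ½ + Σ_{n≥1} ρ(Vn) ≥ 2 C(0)/(V D Z) − ½ = 2 Var_π(g)/(V D) − ½`.
With `g` the (centred) magnetisation of a `V`-site lattice, `Var_π(g) = V χ`: `τ_int,sweep ≥ 2χ/D − ½`. -/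
theorem thinned_tauInt_ge_of_carre_le (hw0 : ∀ x, 0 ≤ w x) (hA1 : A (fun _ => (1 : ℝ)))
    (hAi : ∀ ⦃f h : X → ℝ⦄, A f → A h → Integrable (fun x => f x * h x * w x) μ)
    (hAc : ∀ ⦃f h : X → ℝ⦄ (c : ℝ), A f → A h → A (fun x => f x + c * h x))
    (hAK : ∀ ⦃f : X → ℝ⦄, A f → A (K f))
    (hlin : ∀ ⦃f h : X → ℝ⦄ (c : ℝ), A f → A h →
      ∀ x, K (fun s => f s + c * h s) x = K f x + c * K h x)
    (hsymm : ∀ ⦃f h : X → ℝ⦄, A f → A h →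
      ∫ x, K f x * h x * w x ∂μ = ∫ x, f x * K h x * w x ∂μ)
    (hcontr : ∀ ⦃f : X → ℝ⦄, A f → ∫ x, K f x ^ 2 * w x ∂μ ≤ ∫ x, f x ^ 2 * w x ∂μ)
    (hunit : ∀ x, K (fun _ => (1 : ℝ)) x = 1)
    {g : X → ℝ} (hg : A g) (hg2 : A (fun x => g x ^ 2)) {D : ℝ}
    (hΓ : ∀ x, K (fun y => (g y - g x) ^ 2) x ≤ D) {V : ℕ} (hV : 0 < V)
    (hs : Summable fun n => (∫ x, g x * (K^[V * (n + 1)] g) x * w x ∂μ) / ∫ x, g x ^ 2 * w x ∂μ)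
    (hρV : (∫ x, g x * (K^[V] g) x * w x ∂μ) / (∫ x, g x ^ 2 * w x ∂μ) < 1) :
    2 * (∫ x, g x ^ 2 * w x ∂μ) / (V * D * ∫ x, w x ∂μ) - 1 / 2
      ≤ tauInt (fun n => (∫ x, g x * (K^[V * n] g) x * w x ∂μ) / ∫ x, g x ^ 2 * w x ∂μ) := by
  have hfloor := thinned_tauInt_ge hw0 hAi hAc hAK hlin hsymm hcontr hg hV hs hρV
  have hdir := dirichlet_le_of_carre_le hw0 hA1 hAi hAc hAK hlin hsymm hunit hg hg2 hΓ
  set P := ∫ x, g x ^ 2 * w x ∂μ with hP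
  set Z := ∫ x, w x ∂μ with hZdef
  have hP0 : 0 ≤ P := integral_nonneg fun x => mul_nonneg (sq_nonneg _) (hw0 x)
  have hVpos : (0 : ℝ) < V := by exact_mod_cast hV
  refine le_trans ?_ hfloor
  rcases eq_or_lt_of_le hP0 with hz | hPpos
  · rw [← hz]
    simp only [mul_zero, zero_div, div_zero, sub_zero, mul_one]
    have : 0 ≤ 1 / (V : ℝ) := by positivity
    linarith
  · -- `V (1 − ρ(1)) ≤ V D Z/(2P)`
    have hy : 0 < 1 - (∫ x, g x * K g x * w x ∂μ) / P := by
      -- `C(1) ≤ √(C(0) ∫(Kg)²w) ≤ C(0)`, and `ρ(V) < 1` forces `ρ(1) < 1` via `1 − ρ(V) ≤ V(1 − ρ(1))`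
      have h := one_sub_autocorr_le hw0 hAi hAc hAK hlin hsymm hcontr hg hPpos V
      have hx : 0 < 1 - (∫ x, g x * (K^[V] g) x * w x ∂μ) / P := by linarith
      exact (mul_pos_iff_of_pos_left hVpos).mp (lt_of_lt_of_le hx h)
    have h1 : 1 - (∫ x, g x * K g x * w x ∂μ) / P ≤ D * Z / (2 * P) := by
      have e : 1 - (∫ x, g x * K g x * w x ∂μ) / P = (P - ∫ x, g x * K g x * w x ∂μ) / P := by
        field_simp
      rw [e, div_le_div_iff₀ hPpos (by positivity)]
      nlinarith [hdir, hPpos]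
    have h2 : (V : ℝ) * (1 - (∫ x, g x * K g x * w x ∂μ) / P) ≤ V * D * Z / (2 * P) := by
      have := mul_le_mul_of_nonneg_left h1 hVpos.le
      calc (V : ℝ) * (1 - (∫ x, g x * K g x * w x ∂μ) / P) ≤ V * (D * Z / (2 * P)) := this
        _ = V * D * Z / (2 * P) := by ring
    have h3 := one_div_le_one_div_of_le (mul_pos hVpos hy) h2
    have e3 : 1 / ((V : ℝ) * D * Z / (2 * P)) = 2 * P / (V * D * Z) := by
      rw [one_div_div]
    rw [e3] at h3
    linarith

end RevOp

end Summit.Ventures.LatticeQCDFlow.Exactness
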